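import Literature.Probability.Percolation.MarkedLoopNecessitySevenIff
import Literature.Probability.Percolation.MarkedLoopTripodBasisSeven
import HarnessLib

/-!
# Seven disorders: the holomorphic class-weight observables are a fourteen-parameter family («NECESSITY-SEVEN-BASIS»)

Topic `Literature/Probability/Percolation`; a one-theorem rider on `MarkedLoopNecessitySevenIff.lean` (TRIPOD LAW ⟺ holomorphic on every seven-marked domain) and
`MarkedLoopTripodBasisSeven.lean` (TRIPOD-SOLVED-SEVEN: the tripod-law solutions restricted to the 35 patterns are the span of 14 canonical solutions):
★★★ `forall_holomorphicW_iff_exists_sum_basisW_seven` — a seven-disorder class weight is discretely holomorphic on every seven-marked domain iff its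
restriction to the patterns is a combination of the fourteen canonical solutions `basisW (outer₇ i)`.

## References
* M. Khristoforov, S. Smirnov, *Percolation and O(1) loop model*, arXiv:2111.15612 (2021), §2 Definition 3 and Lemma 4 (arXiv v1 p. 4).

## Mathlib / tree
Tree: `MarkedLoopNecessitySevenIff.lean` (`tripodLaw_iff_forall_holomorphicW_seven`), `MarkedLoopTripodBasisSeven.lean` (`tripodLaw_seven_iff_exists_sum_basisW`, `basisW`,
`outer₇`, `restrictW`).
-/

open Finset

namespace Literature.Probability.Percolation.MarkedLoops

open Literature.Probability.Percolation Literature.Probability.LatticeModels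
open TriMarkedDomain

/-- ★★★ **THE HOLOMORPHIC SEVEN-DISORDER CLASS-WEIGHT OBSERVABLES ARE A FOURTEEN-PARAMETER FAMILY**: `wt` is discretely holomorphic on every
seven-marked domain iff its restriction to the thirty-five patterns is a combination of the fourteen canonical tripod-law solutions of
`MarkedLoopTripodBasisSeven.lean` (necessity above + SOLVED-SEVEN). [cite: KhristoforovSmirnov2021, §2 Definition 3 and Lemma 4 (arXiv v1 p. 4)] -/
theorem forall_holomorphicW_iff_exists_sum_basisW_seven (wt : Fin 7 → Finset (Fin 7 × Fin 7) → ℂ) :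
    (∀ D : TriMarkedDomain 7, HolomorphicW D wt) ↔ ∃ g : Fin 14 → ℂ, restrictW wt = ∑ i : Fin 14, g i • basisW (outer₇ i) := by
  rw [← tripodLaw_iff_forall_holomorphicW_seven, tripodLaw_seven_iff_exists_sum_basisW]

end Literature.Probability.Percolation.MarkedLoops
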